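import Mathlib
import HarnessLib
import Summits.AtomisticToContinuum.FouriersLaw.Theorems.VanishingNoiseTransferVanishingNoiseBoundFlipKuboDirichlet
import Summits.AtomisticToContinuum.FouriersLaw.Theorems.VanishingNoiseTransferVanishingNoiseBoundFlipTestFunctions

/-!
# Every bond carries the response: `⟨g, j_i⟩_{μ_T} = γ⟨g, p_0² − T⟩_{μ_T} − T²` for flip forward fields

`--supports stmt-AtomisticToContinuum-11977` helper file (crux `NoisyFourier`, route `VanishingNoiseTransfer`,
line `sector-dirichlet-gluing`, registered helper `helper_flipBondResponseIdentity` of stub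
`stub_flipConductanceCeiling`).

Setting: the pinned anharmonic chain `pinnedChain ω₂ lam β γ` (all parameters `> 0`), `T > 0`, `L ≥ 2`, any
flip rate `ε`, and a classical equilibrium FORWARD FIELD `g ∈ C² ∩ L²(μ_T)` of the flip-noisy generator:
`(L_{T,T} + εS) g = −(p_0² − T)` pointwise (`S = flipNoise`, Bernardin–Olla's velocity flips). Then for every
genuine bond `i` (`i + 1 < L`), with `j_i = bondCurrent L i = −½(p_i + p_{i+1}) V'(q_{i+1} − q_i)`:

  `⟨g, j_i⟩_{μ_T} = γ ⟨g, p_0² − T⟩_{μ_T} − T²`     (`flip_bondResponse`).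

Proof (the proof of `flip_rowSum` with the block energy `E_{≤i}` of the sites `0..i` in place of `H`):
`(g, k_0 + εSg)` is a forward pair of the plain equilibrium generator (`flip_forwardPair`), and
`(E_{≤i}, γk_0 − j_i)` is a BACKWARD pair: `X_H E_{≤i} = −j_i` (discrete continuity equation,
`HardTether.sum_hamiltonianPart_leftEnergy`) and `S_B E_{≤i} = T − p_0²` (only the left bath touches the block,
`HardTether.bondCurrent_add_generator_leftEnergy`). The cross Green identity `integral_cross_eq` gives
`∫ E_{≤i}(k_0 + εSg) e^{−H/T} = ∫ g(γk_0 − j_i) e^{−H/T}`; on the left `⟨E_{≤i}, Sg⟩ = ⟨S E_{≤i}, g⟩ = 0`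
(`S` symmetric under `μ_T`, `E_{≤i}` even in every momentum) and `⟨E_{≤i}, k_0⟩_{μ_T} = T⟨∂_{p_0}E_{≤i}, p_0⟩ =
T⟨p_0, p_0⟩ = T²` (Gaussian integration by parts, equipartition).

References: Bonetto–Lebowitz–Rey-Bellet 2000 §5.2 eqs. (24)–(27) (all bonds carry the reservoir flux);
Bernardin–Olla 2011 §2.1 (`S` symmetric, `S H = 0`); Eckmann–Pillet–Rey-Bellet 1999 §3; folklore.
-/

noncomputable section

open MeasureTheory Filter Topology
open scoped ContDiff
open Literature.MathematicalPhysics.KineticTheory.HeatConduction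
open Literature.MathematicalPhysics.KineticTheory.HeatConduction.HardTether
  (leftEnergy blockWeight bondCurrent_add_generator_leftEnergy partialP_leftEnergy sum_hamiltonianPart_leftEnergy)
open Summit.AtomisticToContinuum.FouriersLaw.Theorems.SuperadditiveResistance.DeviceLiouville
  (kin kin_eq_sq liouvilleOp bathOp)
open Summit.AtomisticToContinuum.FouriersLaw.Theorems.SuperadditiveResistance.KuboPlain
  (generator_eq_liouvilleOp_add_bathOp)
open Summit.AtomisticToContinuum.FouriersLaw.Cruxes.SuperadditiveResistance.FloatingProbeBypassLaplacian
  (pinnedChain_memLp_two_snd pinnedChain_memLp_two_snd_sq pinnedChain_integral_snd_sq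
    integral_mul_sq_sub_gibbsMeasure)
open Summit.AtomisticToContinuum.FouriersLaw.Cruxes.ConductanceLowerBound.ForecastSensitivity
  (integral_cross_eq sum_ite_val_eq)
open Summit.AtomisticToContinuum.FouriersLaw.Cruxes.SuperadditiveResistance.InsertionToolbox
  (pinnedChain_memLp_two_of_abs_le)
open Summit.AtomisticToContinuum.FouriersLaw.Theorems.VanishingNoiseBound
  (memLp_comp_momentumFlip memLp_flipNoise flip_forwardPair gibbs_flipInvariant contDiff_leftEnergy'
    leftEnergy_mem_Icc leftEnergy_momentumFlip flipNoise_eq_zero_of_invariant)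

namespace Summit.AtomisticToContinuum.FouriersLaw.Theorems.NoisyFourier.FlipCeiling

/-! ## The block energy `E_{≤i}` is a backward pair with source `γ(p_0² − T) − j_i` -/

section BlockEnergy

variable {L : ℕ}

/-- **Discrete continuity equation in operator form**: `X_H E_{≤i} = −j_i` for differentiable potentials.
[Bonetto–Lebowitz–Rey-Bellet 2000, §5.2 eqs. (25)–(26)] [folklore] -/
theorem liouvilleOp_leftEnergy (P : OscillatorChain) (hU : Differentiable ℝ P.U) (hV : Differentiable ℝ P.V)
    (i : Fin L) (x : PhaseSpace L) :
    liouvilleOp P L (leftEnergy P L i) x = -P.bondCurrent L i x := by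
  unfold liouvilleOp
  exact sum_hamiltonianPart_leftEnergy P hU hV i x

variable {ω₂ lam β γ : ℝ}

/-- **The block energy is a backward pair.** For a genuine bond `i` (`i + 1 < L`) of the pinned chain:
`−X_H E_{≤i} + γ S_{bathWeight} E_{≤i} = −(γ(p_0² − T) − j_i)` — only the left thermostat touches the block
`{0, …, i}` and `S_{bathWeight} E_{≤i} = T − p_0²`. [Bonetto–Lebowitz–Rey-Bellet 2000, §5.2] [folklore] -/
theorem leftEnergy_backwardPair (T : ℝ) {i : Fin L} (hi : i.val + 1 < L) (x : PhaseSpace L) :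
    -1 * liouvilleOp (pinnedChain ω₂ lam β γ) L (leftEnergy (pinnedChain ω₂ lam β γ) L i) x +
        γ * bathOp L (OscillatorChain.bathWeight L) T (leftEnergy (pinnedChain ω₂ lam β γ) L i) x =
      -(γ * (kin L 0 x - T) - (pinnedChain ω₂ lam β γ).bondCurrent L i x) := by
  have hL0 : 0 < L := by omega
  have hU : Differentiable ℝ (pinnedChain ω₂ lam β γ).U :=
    (pinnedChain_contDiff_U ω₂ lam β γ (n := 1)).differentiable one_ne_zero
  have hV : Differentiable ℝ (pinnedChain ω₂ lam β γ).V :=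
    (pinnedChain_contDiff_V ω₂ lam β γ (n := 1)).differentiable one_ne_zero
  have hliou := liouvilleOp_leftEnergy (pinnedChain ω₂ lam β γ) hU hV i x
  have hgen := generator_eq_liouvilleOp_add_bathOp (pinnedChain ω₂ lam β γ) L T
    (leftEnergy (pinnedChain ω₂ lam β γ) L i) x
  have hbal := bondCurrent_add_generator_leftEnergy (pinnedChain ω₂ lam β γ) hU hV hi T T x
  rw [Cruxes.ConductanceLowerBound.ForecastSensitivity.sum_ite_val_eq hL0 (fun k => T - x.2 k ^ 2)] at hbal
  rw [show (pinnedChain ω₂ lam β γ).γ = γ from rfl] at hgen hbal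
  rw [kin_eq_sq hL0]
  linear_combination hbal - hgen - 2 * hliou

end BlockEnergy

/-! ## Every bond carries the response -/

section BondResponse

variable {ω₂ lam β γ : ℝ}

/-- **Every bond carries the response of a flip forward field**: for the pinned chain (all parameters `> 0`),
`T > 0`, `L ≥ 2`, any `ε`, every classical `C² ∩ L²(μ_T)` solution `g` of `(L_{T,T} + εS) g = −(p_0² − T)` and
every genuine bond `i` (`i + 1 < L`): `⟨g, j_i⟩_{μ_T} = γ⟨g, p_0² − T⟩_{μ_T} − T²`. Proof: the cross Green
identity (`integral_cross_eq`) for the forward pair `(g, k_0 + εSg)` against the backward pair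
`(E_{≤i}, γk_0 − j_i)`, then `⟨E_{≤i}, Sg⟩ = ⟨S E_{≤i}, g⟩ = 0` and `⟨E_{≤i}, k_0⟩_{μ_T} = T⟨p_0, p_0⟩ = T²`.
[Bonetto–Lebowitz–Rey-Bellet 2000, §5.2 eqs. (24)–(27)] [folklore] -/
theorem flip_bondResponse (hω : 0 < ω₂) (hl : 0 < lam) (hβ : 0 < β) (hγ : 0 < γ) {T : ℝ} (hT : 0 < T)
    (ε : ℝ) {L : ℕ} (hL : 2 ≤ L) {g : PhaseSpace L → ℝ} (hg2 : ContDiff ℝ 2 g)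
    (hgL : MemLp g 2 ((pinnedChain ω₂ lam β γ).gibbsMeasure L T))
    (hpde : ∀ x, (pinnedChain ω₂ lam β γ).flipGenerator L T T ε g x = -(kin L 0 x - T))
    {i : Fin L} (hi : i.val + 1 < L) :
    ∫ x, g x * (pinnedChain ω₂ lam β γ).bondCurrent L i x ∂((pinnedChain ω₂ lam β γ).gibbsMeasure L T) =
      γ * ∫ x, g x * (kin L 0 x - T) ∂((pinnedChain ω₂ lam β γ).gibbsMeasure L T) - T ^ 2 := by
  have hL0 : 0 < L := by omega
  set P := pinnedChain ω₂ lam β γ with hP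
  set μ := P.gibbsMeasure L T with hμdef
  set E := leftEnergy P L i with hE
  set B := OscillatorChain.bathWeight L with hB
  haveI : IsProbabilityMeasure μ := pinnedChain_isProbabilityMeasure_gibbsMeasure hω hl.le hβ.le γ L hT
  have hflip := gibbs_flipInvariant (ω₂ := ω₂) (lam := lam) (β := β) (γ := γ) L T
  -- regularity and size of the block energy `E`
  have hU : ContDiff ℝ ∞ P.U := pinnedChain_contDiff_U ω₂ lam β γ
  have hV : ContDiff ℝ ∞ P.V := pinnedChain_contDiff_V ω₂ lam β γ
  have hEs : ContDiff ℝ ∞ E := contDiff_leftEnergy' P hU hV L i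
  have hE2 : ContDiff ℝ 2 E := hEs.of_le (by norm_cast)
  have hEd : Differentiable ℝ E := hE2.differentiable two_ne_zero
  have hU0 : ∀ q, 0 ≤ P.U q := fun q => by
    show 0 ≤ ω₂ * q ^ 2 / 2 + lam * q ^ 4 / 4
    positivity
  have hV0 : ∀ r, 0 ≤ P.V r := fun r => by
    show 0 ≤ r ^ 2 / 2 + β * r ^ 4 / 4
    positivity
  have hEicc : ∀ x, 0 ≤ E x ∧ E x ≤ P.hamiltonian L x := fun x => leftEnergy_mem_Icc P hU0 hV0 L i x
  -- square integrability of the players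
  have hEL2 : MemLp E 2 μ :=
    pinnedChain_memLp_two_of_abs_le hω hl.le hβ.le γ L hT hEs.continuous (C := 1) (k := 1) fun x => by
      obtain ⟨h0, h1⟩ := hEicc x
      rw [abs_of_nonneg h0, pow_one, one_mul]
      linarith
  have hk0L2 : MemLp (fun x => kin L 0 x - T) 2 μ :=
    ((pinnedChain_memLp_two_snd_sq hω hl.le hβ.le γ L hT ⟨0, hL0⟩).sub (memLp_const T)).ae_eq
      (ae_of_all _ fun x => by simp [kin_eq_sq hL0])
  have hjL2 : MemLp (P.bondCurrent L i) 2 μ :=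
    pinnedChain_memLp_two_of_abs_le hω hl.le hβ.le γ L hT (pinnedChain_continuous_bondCurrent ω₂ lam β γ L i)
      (C := (L : ℝ) * ((3 + β) / 2)) (k := 2) fun x => by
      calc |P.bondCurrent L i x| ≤ L * ((3 + β) / 2 * (1 + P.hamiltonian L x) ^ 2) :=
            pinnedChain_abs_bondCurrent_le hω.le hl.le hβ.le γ L i x
        _ = (L : ℝ) * ((3 + β) / 2) * (1 + P.hamiltonian L x) ^ 2 := by ring
  have hkEL2 : MemLp (fun x => γ * (kin L 0 x - T) - P.bondCurrent L i x) 2 μ := (hk0L2.const_mul γ).sub hjL2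
  have hSgL2 : MemLp (flipNoise L g) 2 μ := memLp_flipNoise hflip hgL
  set k' : PhaseSpace L → ℝ := fun x => (kin L 0 x - T) + ε * flipNoise L g x with hk'
  have hk'L2 : MemLp k' 2 μ := hk0L2.add (hSgL2.const_mul ε)
  -- the two pairs
  have hB0 : ∀ i, 0 ≤ B i := by
    intro i
    simp only [hB, OscillatorChain.bathWeight]
    positivity
  have hpg : ∀ x, 1 * liouvilleOp P L g x + γ * bathOp L B T g x = -k' x := fun x =>
    flip_forwardPair (ω₂ := ω₂) (lam := lam) (β := β) (γ := γ) L T ε (k := fun y => kin L 0 y - T) hpde x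
  have hpE : ∀ x, -1 * liouvilleOp P L E x + γ * bathOp L B T E x =
      -(γ * (kin L 0 x - T) - P.bondCurrent L i x) := fun x =>
    leftEnergy_backwardPair (ω₂ := ω₂) (lam := lam) (β := β) (γ := γ) T hi x
  -- the cross identity, cutoff removed, in Gibbs-measure form
  have hρeq : ∫ x, E x * k' x * P.gibbsDensity L T x =
      ∫ x, g x * (γ * (kin L 0 x - T) - P.bondCurrent L i x) * P.gibbsDensity L T x :=
    integral_cross_eq hω hl.le hβ.le L hT B hB0 1 hγ hg2 hE2 hgL hk'L2 hEL2 hkEL2 hpg hpE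
  have hμeq : ∫ x, g x * (γ * (kin L 0 x - T) - P.bondCurrent L i x) ∂μ = ∫ x, E x * k' x ∂μ := by
    rw [P.integral_gibbsMeasure, P.integral_gibbsMeasure, hρeq]
  -- `⟨E, k'⟩ = ⟨E, k_0⟩ + ε⟨E, Sg⟩ = T² + 0`
  have hEk0 : ∫ x, E x * (kin L 0 x - T) ∂μ = T ^ 2 := by
    have hdE : ∀ x, partialP (⟨0, hL0⟩ : Fin L) E x = x.2 ⟨0, hL0⟩ := fun x => by
      rw [hE, partialP_leftEnergy P i ⟨0, hL0⟩]
      simp [blockWeight]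
    have hdEL2 : MemLp (partialP (⟨0, hL0⟩ : Fin L) E) 2 μ := by
      rw [show partialP (⟨0, hL0⟩ : Fin L) E = fun x => x.2 ⟨0, hL0⟩ from funext hdE]
      exact pinnedChain_memLp_two_snd hω hl.le hβ.le γ L hT _
    have e1 : ∫ x, E x * (kin L 0 x - T) ∂μ = ∫ x, E x * (x.2 ⟨0, hL0⟩ ^ 2 - T) ∂μ :=
      integral_congr_ae (ae_of_all _ fun x => by dsimp only; rw [kin_eq_sq hL0])
    have e2 : ∫ x, partialP (⟨0, hL0⟩ : Fin L) E x * x.2 ⟨0, hL0⟩ ∂μ = ∫ x, x.2 ⟨0, hL0⟩ ^ 2 ∂μ :=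
      integral_congr_ae (ae_of_all _ fun x => by dsimp only; rw [hdE x]; ring)
    rw [e1, integral_mul_sq_sub_gibbsMeasure hω hl.le hβ.le γ L hT ⟨0, hL0⟩ hEd hEL2 hdEL2, e2,
      pinnedChain_integral_snd_sq hω hl.le hβ.le γ L hT ⟨0, hL0⟩]
    ring
  have hES : ∫ x, E x * flipNoise L g x ∂μ = 0 := by
    have hgi : ∀ i, MemLp (fun x => g (momentumFlip i x)) 2 μ := memLp_comp_momentumFlip hflip hgL
    rw [integral_mul_flipNoise hflip (hEL2.integrable_mul hgL) (fun i => hEL2.integrable_mul (hgi i))]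
    have h0 : flipNoise L E = fun _ => 0 :=
      funext fun x => flipNoise_eq_zero_of_invariant (fun k y => leftEnergy_momentumFlip P i k y) x
    simp [h0]
  have hEk' : ∫ x, E x * k' x ∂μ = T ^ 2 := by
    have i1 : Integrable (fun x => E x * (kin L 0 x - T)) μ := hEL2.integrable_mul hk0L2
    have i2 : Integrable (fun x => E x * flipNoise L g x) μ := hEL2.integrable_mul hSgL2
    have e : (fun x => E x * k' x) = fun x => E x * (kin L 0 x - T) + ε * (E x * flipNoise L g x) := by
      funext x; rw [hk']; ring
    rw [e, integral_add i1 (i2.const_mul ε), integral_const_mul, hES, hEk0]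
    ring
  -- split the pairing with `γk_0 − j_i`
  have hsplit : ∫ x, g x * (γ * (kin L 0 x - T) - P.bondCurrent L i x) ∂μ =
      γ * (∫ x, g x * (kin L 0 x - T) ∂μ) - ∫ x, g x * P.bondCurrent L i x ∂μ := by
    have i1 : Integrable (fun x => g x * (kin L 0 x - T)) μ := hgL.integrable_mul hk0L2
    have i2 : Integrable (fun x => g x * P.bondCurrent L i x) μ := hgL.integrable_mul hjL2
    rw [← integral_const_mul, ← integral_sub (i1.const_mul γ) i2]
    exact integral_congr_ae (ae_of_all _ fun x => by ring)
  have hfin : γ * (∫ x, g x * (kin L 0 x - T) ∂μ) - ∫ x, g x * P.bondCurrent L i x ∂μ = T ^ 2 := by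
    rw [← hsplit, hμeq, hEk']
  linarith

end BondResponse

/-! ## Registered helper -/

/-- Registered helper sub-goal `helper_flipBondResponseIdentity` of stub `stub_flipConductanceCeiling` (line
`sector-dirichlet-gluing`, crux stmt-AtomisticToContinuum-11977): every genuine bond carries the response of a
classical `C² ∩ L²(μ_T)` forward field `g` of the flip-noisy equilibrium generator,
`(L_{T,T} + εS) g = −(p_0² − T)` (`L ≥ 2`, any `ε`, `i + 1 < L`): `⟨g, j_i⟩_{μ_T} = γ⟨g, p_0² − T⟩_{μ_T} − T²`
(`flip_bondResponse`). [Bonetto–Lebowitz–Rey-Bellet 2000, §5.2] [folklore] -/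
theorem helper_flipBondResponseIdentity : ∀ (ω₂ lam β γ T ε : ℝ), 0 < ω₂ → 0 < lam → 0 < β → 0 < γ → 0 < T → ∀ (L : ℕ), 2 ≤ L → ∀ g : Literature.MathematicalPhysics.KineticTheory.HeatConduction.PhaseSpace L → ℝ, ContDiff ℝ 2 g → MeasureTheory.MemLp g 2 ((Literature.MathematicalPhysics.KineticTheory.HeatConduction.pinnedChain ω₂ lam β γ).gibbsMeasure L T) → (∀ x, (Literature.MathematicalPhysics.KineticTheory.HeatConduction.pinnedChain ω₂ lam β γ).flipGenerator L T T ε g x = -(Summit.AtomisticToContinuum.FouriersLaw.Theorems.SuperadditiveResistance.DeviceLiouville.kin L 0 x - T)) → ∀ (i : Fin L), i.val + 1 < L → MeasureTheory.integral ((Literature.MathematicalPhysics.KineticTheory.HeatConduction.pinnedChain ω₂ lam β γ).gibbsMeasure L T) (fun x => g x * (Literature.MathematicalPhysics.KineticTheory.HeatConduction.pinnedChain ω₂ lam β γ).bondCurrent L i x) = γ * MeasureTheory.integral ((Literature.MathematicalPhysics.KineticTheory.HeatConduction.pinnedChain ω₂ lam β γ).gibbsMeasure L T) (fun x => g x * (Summit.AtomisticToContinuum.FouriersLaw.Theorems.SuperadditiveResistance.DeviceLiouville.kin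 L 0 x - T)) - T ^ 2 :=
  fun _ _ _ _ _ ε hω hl hβ hγ hT _ hL _ hg2 hgL hpde _ hi => flip_bondResponse hω hl hβ hγ hT ε hL hg2 hgL hpde hi

end Summit.AtomisticToContinuum.FouriersLaw.Theorems.NoisyFourier.FlipCeiling

end
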